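import Literature.Probability.FitznerVanDerHofstad2017.SrwIntegralSupZero
import Literature.Probability.FitznerVanDerHofstad2017.SrwIntegralMonotone
import Literature.Barriers.CriticalPhenomena.HvdHTorusShift
import Mathlib.Analysis.SpecificLimits.Normed
import Mathlib.Analysis.Convex.Mul
import Mathlib.Analysis.Convex.Jensen
import HarnessLib

/-!
# SRW integrals in large dimensions: the finite Taylor form of `I_{n,l}(x)`, monotonicity of
# `I_{n,l}(0)` in the dimension `d`, and the resulting large-`d` enclosure

CITATION HEADER. This module is part of a certified REPRODUCTION of:
R. Fitzner, R. van der Hofstad, *Generalized approach to the non-backtracking lace expansion*,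
Probab. Theory Related Fields **169** (2017) 1041–1119 [NoBLE17] (arXiv:1506.07969), §5 (the SRW
inputs `I_{n,l}(x)`, (5.1) p. 1090), as consumed by *Mean-field behavior for nearest-neighbor
percolation in `d > 10`*, Electron. J. Probab. **22** (2017) no. 43 [FvdH17], Thm 1.1 ("`d ≥ 11`").
The step "verified at one dimension ⇒ all larger dimensions" is asserted in [NoBLE17] twice —
§2.5 p. 1062: "Since the bounds are monotone in the dimension, the bounds then also follow for all
dimensions larger than that specific dimension."; §6 p. 1104: "it is also explained how we can then
use monotonicity in the dimension `d` to obtain the result for all dimensions larger than the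
specified dimension" — without proof for percolation (the LT/LA sequel, J. Stat. Phys. **185**
(2021) no. 13, §9, Def. 9.1 / Lemma 9.2, proves `d`-monotonicity of `I_{n,0}(x)`, `‖x‖_∞ ≤ 2`, via
Bessel functions, for lattice animals from `d = 30`). This file supplies KERNEL facts about the
SRW inputs `I_{n,l}(x) = srwI d n l x` (`SrwIntegralBounds.lean`) that make a uniform-in-`d`
certificate possible:

* `srwI_eq_srwLaw_add_sum`, **`srwI_taylor`** — the FINITE Taylor form of (5.1):
  `I_{n+1,l}(x) = Σ_{i ≤ R} C(i+n, n) p_{l+i}(x) + Σ_{t ≤ n} C(R+t, t) I_{n+1-t, l+R+1}(x)`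
  (pure algebra from `I_{n+1,m+1} = I_{n+1,m} - I_{n,m}` and `I_{0,m} = p_m`; the `p_i(x)` are
  walk counts `/(2d)^i`, rational polynomials in `1/d` for fixed `x`);
* **`srwI_zero_dim_succ_le`** — MONOTONICITY IN THE DIMENSION at the origin:
  `I^{(d+1)}_{j,m}(0) ≤ I^{(d)}_{j,m}(0)` for even `m` and `d ≥ 2j+1`, hence `srwI_zero_dim_anti`
  (`d ≤ d'`) and `srwLaw_zero_dim_anti` (return probabilities). Proof (leave-one-out Jensen /
  reverse-martingale property of sample means): `D̂_{d+1}(k)` is the average of the `d+1` numbers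
  `D̂_d(k^{(i)})` (`k^{(i)}` = `k` with coordinate `i` deleted, `Dhat_succ_eq_avg`); the integrand
  `φ(t) = t^m (1-t)^{-j}` has the same integral as its even part `ψ` (shift `k ↦ k + π𝟙`,
  `integral_P_comp_add`), and `ψ(t) = Σ_n C(n+j-1, j-1) (t^{n+m} + (-t)^{n+m})/2` (`hasSum_psi`)
  is a nonnegative combination of even powers, so `ψ(mean) ≤ mean of ψ` termwise (finite Jensen
  for `t ↦ t^{2q}`, `psi_avg_le`); integrating and deleting one coordinate
  (`measurePreserving_piFinSuccAbove`, `integral_P_succ_comp_succAbove`) gives the claim;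
* **`abs_srwI_sub_taylor_le`** — the LARGE-`d` ENCLOSURE: for `D₀ ≤ d`, `2(n+1)+1 ≤ D₀` and
  `l + R + 1` even, `|I^{(d)}_{n+1,l}(x) - Σ_{i ≤ R} C(i+n,n) p^{(d)}_{l+i}(x)| ≤
  Σ_{t ≤ n} C(R+t,t) I^{(D₀)}_{n+1-t, l+R+1}(0)`: every SRW input at every `d ≥ D₀` is an
  explicit rational (walk counts) up to a remainder certified ONCE, at `d = D₀`
  (uses `abs_srwI_le_srwI_zero_of_even` of `SrwIntegralSupZero.lean`).

No hypothesis of any theorem here is a programme-internal claim: all statements are kernel-proved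
from the tree's definitions (`srwI`, `srwLaw`, `Dhat`, `Chat`, `P`).

## References
* [NoBLE17] R. Fitzner, R. van der Hofstad, PTRF 169 (2017) 1041–1119: (5.1) p. 1090; §2.5
  p. 1062; §6 p. 1104 (bib key `FitznerVanDerHofstad2016NoBLE`).
* [FvdH17] R. Fitzner, R. van der Hofstad, EJP 22 (2017) no. 43, Thm 1.1, Thm 1.2 p. 5.
* R. Fitzner, R. van der Hofstad, J. Stat. Phys. 185 (2021) no. 13, §9 (Def. 9.1, Lemma 9.2)
  (arXiv:1905.02785) — the printed `d`-monotonicity argument for lattice animals.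
* M. Heydenreich, R. van der Hofstad, *Progress in high-dimensional percolation and random graphs*
  (2017), Exercise 5.4 / Prop. 5.5 (bib key `HeydenreichVanDerHofstad2017`) — torus shifts and
  integrability of `Ĉⁿ`, `d ≥ 2n+1`, as used from `HvdHTorusShift.lean`.
-/

noncomputable section

open MeasureTheory Real Finset Filter Topology
open scoped BigOperators

namespace Literature.Probability.FitznerVanDerHofstad2017

open Literature.Barriers.CriticalPhenomena
open Literature.Barriers.CriticalPhenomena.Slade2006Prop53 (P μI)
open Literature.Barriers.CriticalPhenomena.LongRangePhi4 (srwLaw srwLaw_nonneg)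

variable {d : ℕ}

/-! ### Part 1. The finite Taylor form of `I_{n,l}(x)` -/

/-- `I_{n,l}(x) = p_l(x) + Σ_{j<n} I_{j+1,l+1}(x)` (`d ≥ 2n+1`): telescoping (5.1) in `n`.
[cite: FitznerVanDerHofstad2016NoBLE, (5.1) p. 1090] -/
theorem srwI_eq_srwLaw_add_sum (n l : ℕ) (hd : 2 * n + 1 ≤ d) (x : Fin d → ℤ) :
    srwI d n l x = srwLaw d l x + ∑ j ∈ range n, srwI d (j + 1) (l + 1) x := by
  induction n with
  | zero => simp [srwI_zero_eq_srwLaw]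
  | succ n ih =>
    have h := srwI_succ_succ (n := n) hd l x
    have ih' := ih (by omega)
    rw [sum_range_succ]
    linarith

/-- **Finite Taylor form of the SRW integrals**: for `d ≥ 2(n+1)+1` and every `l, R`,
`I_{n+1,l}(x) = Σ_{i=0}^{R} C(i+n,n) p_{l+i}(x) + Σ_{t=0}^{n} C(R+t,t) I_{n+1-t,l+R+1}(x)`
(all `I_{n',m}` on the right have `n' ≥ 1`). Pure algebra from (5.1) and `I_{0,m} = p_m`.
[cite: FitznerVanDerHofstad2016NoBLE, (5.1) p. 1090] -/
theorem srwI_taylor (n l R : ℕ) (hd : 2 * (n + 1) + 1 ≤ d) (x : Fin d → ℤ) :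
    srwI d (n + 1) l x =
      ∑ i ∈ range (R + 1), (((i + n).choose n : ℕ) : ℝ) * srwLaw d (l + i) x +
      ∑ t ∈ range (n + 1), (((R + t).choose t : ℕ) : ℝ) * srwI d (n + 1 - t) (l + R + 1) x := by
  induction R with
  | zero =>
    rw [srwI_eq_srwLaw_add_sum (n + 1) l hd x, sum_range_one]
    simp only [zero_add, Nat.choose_self, Nat.cast_one, one_mul, add_zero]
    congr 1
    rw [← sum_range_reflect]
    refine sum_congr rfl fun j hj => ?_
    rw [mem_range] at hj
    congr 2; omega
  | succ R ih =>
    rw [ih, sum_range_succ _ (R + 1)]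
    -- expand every remainder term by one step
    have hexp : ∀ t ∈ range (n + 1), (((R + t).choose t : ℕ) : ℝ) * srwI d (n + 1 - t) (l + R + 1) x
        = (((R + t).choose t : ℕ) : ℝ) * srwLaw d (l + R + 1) x +
          ∑ j ∈ range (n + 1 - t), (((R + t).choose t : ℕ) : ℝ) * srwI d (j + 1) (l + R + 2) x := by
      intro t ht
      rw [mem_range] at ht
      rw [srwI_eq_srwLaw_add_sum (n + 1 - t) (l + R + 1) (by omega) x, mul_add, mul_sum]
    rw [sum_congr rfl hexp, sum_add_distrib]
    -- the `p_{l+R+1}` coefficient: hockey stick `Σ_{t ≤ n} C(R+t,t) = C(R+1+n,n)`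
    have hcoef : ∑ t ∈ range (n + 1), (((R + t).choose t : ℕ) : ℝ) = (((R + 1 + n).choose n : ℕ) : ℝ) := by
      rw [← Nat.cast_sum]
      congr 1
      have h := Nat.sum_range_add_choose n R
      rw [Nat.choose_symm_of_eq_add (by ring : R + 1 + n = n + (R + 1)),
        show R + 1 + n = n + R + 1 by ring, ← h]
      exact sum_congr rfl fun t _ => by rw [Nat.choose_symm_of_eq_add (add_comm R t), add_comm R t]
    -- the remainder coefficients: interchange the triangle and use the hockey stick again
    have htri : ∑ t ∈ range (n + 1), ∑ j ∈ range (n + 1 - t),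
        (((R + t).choose t : ℕ) : ℝ) * srwI d (j + 1) (l + R + 2) x =
        ∑ j ∈ range (n + 1), (((R + 1 + (n - j)).choose (n - j) : ℕ) : ℝ) * srwI d (j + 1) (l + R + 2) x := by
      rw [sum_comm' (t' := range (n + 1)) (s' := fun j => range (n + 1 - j))
        (h := fun t j => by simp only [mem_range]; omega)]
      refine sum_congr rfl fun j hj => ?_
      rw [mem_range] at hj
      rw [← sum_mul]
      congr 1
      rw [← Nat.cast_sum]
      congr 1
      have h := Nat.sum_range_add_choose (n - j) R
      rw [show n + 1 - j = n - j + 1 by omega]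
      rw [Nat.choose_symm_of_eq_add (by ring : R + 1 + (n - j) = (n - j) + (R + 1)),
        show R + 1 + (n - j) = n - j + R + 1 by ring, ← h]
      exact sum_congr rfl fun t _ => by rw [Nat.choose_symm_of_eq_add (add_comm R t), add_comm R t]
    rw [htri, ← sum_mul, hcoef]
    have hlast : ∑ t ∈ range (n + 1), (((R + 1 + t).choose t : ℕ) : ℝ) * srwI d (n + 1 - t) (l + (R + 1) + 1) x
        = ∑ j ∈ range (n + 1), (((R + 1 + (n - j)).choose (n - j) : ℕ) : ℝ) * srwI d (j + 1) (l + R + 2) x := by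
      rw [← sum_range_reflect]
      refine sum_congr rfl fun j hj => ?_
      rw [mem_range] at hj
      rw [show n + 1 - 1 - j = n - j by omega, show n + 1 - (n - j) = j + 1 by omega,
        show l + (R + 1) + 1 = l + R + 2 by ring]
    rw [hlast, show l + (R + 1) = l + R + 1 by ring]
    ring

/-! ### Part 2. Monotonicity of `I_{j,m}(0)` in the dimension `d` -/

namespace DimMono

/-- The integrand of `I_{j,m}(0)` as a function of `t = D̂(k)`: `φ_{j,m}(t) = t^m (1/(1-t))^j`.
[folklore] -/
def phi (j m : ℕ) (t : ℝ) : ℝ := t ^ m * (1 / (1 - t)) ^ j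

/-- The even part `ψ_{j,m}(t) = (φ_{j,m}(t) + φ_{j,m}(-t))/2`. [folklore] -/
def psi (j m : ℕ) (t : ℝ) : ℝ := (phi j m t + phi j m (-t)) / 2

/-- `φ` is measurable. [folklore] -/
theorem measurable_phi (j m : ℕ) : Measurable (phi j m) :=
  (measurable_id.pow_const m).mul
    ((measurable_const.div (measurable_const.sub measurable_id)).pow_const j)

/-- `I_{j,m}(0) = ∫ φ_{j,m}(D̂(k)) dk/(2π)^d`. [folklore] -/
theorem srwI_zero_eq_integral_phi (d j m : ℕ) :
    srwI d j m 0 = (∫ k, phi j m (Dhat d k) ∂P d) / (2 * π) ^ d := by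
  simp only [srwI, DhatSym_zero, mul_one, Chat, one_mul, phi]

/-- `D̂(k + π𝟙) = -D̂(k)`. [folklore] -/
theorem Dhat_add_pi (k : Fin d → ℝ) : Dhat d (k + fun _ => π) = -Dhat d k := by
  simp only [Dhat_def, Pi.add_apply, Real.cos_add_pi, sum_neg_distrib, neg_div]

/-- `D̂(k + 2πn) = D̂(k)` for `n ∈ ℤ^d` — PRIVATE local copy (statement and proof identical) of
`HvdHTorusShift.lean`'s `Dhat_add_twoPi_mul`, which is being made `private` there: it restates
`GaussianDominationRouteLemma86.lean`'s `Dhat_add_two_pi_mul_int`, and that file cannot be imported into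
this stack until the duplicate ROOT names of `HvdHRandomWalkTriangles.lean` /
`GaussianDominationRouteRandomWalk.lean` are retired (REFEREE v27 C37 = REFEREE-2 R14 / GAPS G19-add;
step 1 of 4 of the lean2-g9 sequence LargeD → Shifted → TorusShift → Triangles). [folklore] -/
private theorem Dhat_add_twoPi_mulRW (k : Fin d → ℝ) (n : Fin d → ℤ) :
    Dhat d (fun j => k j + 2 * π * n j) = Dhat d k := by
  simp only [Dhat]
  congr 1
  refine Finset.sum_congr rfl fun j _ => ?_
  rw [mul_comm (2 * π), Real.cos_add_int_mul_two_pi]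

/-- Reflection `k ↦ k + π𝟙`: `∫ φ(-D̂) = ∫ φ(D̂)` on the cube.
[cite: HeydenreichVanDerHofstad2017, Exercise 5.4 and (8.3.37)] -/
theorem integral_phi_neg_Dhat (d j m : ℕ) :
    ∫ k, phi j m (-Dhat d k) ∂P d = ∫ k, phi j m (Dhat d k) ∂P d := by
  have h := integral_P_comp_add (F := fun k => phi j m (Dhat d k))
    ((measurable_phi j m).comp (continuous_Dhat d).measurable)
    (fun k n => by simp only [Dhat_add_twoPi_mulRW]) (fun _ => π)
  simpa only [Dhat_add_pi] using h

/-- `φ_{j,m}(D̂)` is integrable on the cube for `d ≥ 2j+1`.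
[cite: HeydenreichVanDerHofstad2017, Prop. 5.5] -/
theorem integrable_phi_Dhat {j : ℕ} (hd : 2 * j + 1 ≤ d) (m : ℕ) :
    Integrable (fun k => phi j m (Dhat d k)) (P d) := by
  have h := integrable_weight_mul_Chat_pow hd (w := fun k => Dhat d k ^ m)
    ((continuous_Dhat d).measurable.pow_const m)
    (fun k => by rw [abs_pow]; exact abs_Dhat_pow_le_one m k)
  refine h.congr (ae_of_all _ fun k => ?_)
  simp only [phi, Chat, one_mul]

/-- `φ_{j,m}(-D̂)` is integrable on the cube for `d ≥ 2j+1` (it is `φ_{j,m}(D̂(· + π𝟙))`).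
[cite: HeydenreichVanDerHofstad2017, Exercise 5.4 and Prop. 5.5] -/
theorem integrable_phi_neg_Dhat {j : ℕ} (hd : 2 * j + 1 ≤ d) (m : ℕ) :
    Integrable (fun k => phi j m (-Dhat d k)) (P d) := by
  have hmeas : Measurable (fun k : Fin d → ℝ => Dhat d (k + fun _ => π) ^ m) :=
    ((continuous_Dhat d).measurable.comp (measurable_add_const _)).pow_const m
  have h := (integrable_Chat_shift_pow j hd zero_le_one le_rfl (fun _ => π)).bdd_mul (c := 1)
    hmeas.aestronglyMeasurable
    (ae_of_all _ fun k => by rw [Real.norm_eq_abs, abs_pow]; exact abs_Dhat_pow_le_one m _)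
  refine h.congr (ae_of_all _ fun k => ?_)
  simp only [phi, Chat, one_mul, Dhat_add_pi, sub_neg_eq_add]

/-- `ψ_{j,m}(D̂)` is integrable on the cube for `d ≥ 2j+1`. [folklore] -/
theorem integrable_psi_Dhat {j : ℕ} (hd : 2 * j + 1 ≤ d) (m : ℕ) :
    Integrable (fun k => psi j m (Dhat d k)) (P d) := by
  have h := ((integrable_phi_Dhat hd m).add (integrable_phi_neg_Dhat hd m)).div_const 2
  refine h.congr (ae_of_all _ fun k => ?_)
  simp only [Pi.add_apply, psi]

/-- `∫ ψ(D̂) = ∫ φ(D̂)`: the odd part of the integrand integrates to zero. [folklore] -/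
theorem integral_psi_Dhat {j : ℕ} (hd : 2 * j + 1 ≤ d) (m : ℕ) :
    ∫ k, psi j m (Dhat d k) ∂P d = ∫ k, phi j m (Dhat d k) ∂P d := by
  simp only [psi]
  rw [integral_div, integral_add (integrable_phi_Dhat hd m) (integrable_phi_neg_Dhat hd m),
    integral_phi_neg_Dhat]
  ring

/-- **Leave-one-out identity**: `D̂_{d+1}(k)` is the average over `i` of `D̂_d(k^{(i)})`, where
`k^{(i)}` is `k` with coordinate `i` deleted (`d ≥ 1`). [folklore] -/
theorem Dhat_succ_eq_avg (hd : 1 ≤ d) (k : Fin (d + 1) → ℝ) :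
    Dhat (d + 1) k = (∑ i : Fin (d + 1), Dhat d (fun j => k (i.succAbove j))) / (d + 1) := by
  have hS : ∀ i : Fin (d + 1), ∑ j : Fin d, Real.cos (k (i.succAbove j)) =
      (∑ l, Real.cos (k l)) - Real.cos (k i) := by
    intro i
    rw [Fin.sum_univ_succAbove (fun l => Real.cos (k l)) i]
    ring
  have hd0 : (d : ℝ) ≠ 0 := by exact_mod_cast (by omega : d ≠ 0)
  simp only [Dhat_def, hS, sub_div]
  rw [sum_sub_distrib, sum_const, card_univ, Fintype.card_fin, nsmul_eq_mul, ← sum_div]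
  push_cast
  field_simp
  ring

/-- For a.e. `k` in the cube no coordinate has `sin k_l = 0`. [folklore] -/
theorem ae_forall_sin_ne_zero (d : ℕ) : ∀ᵐ k ∂P d, ∀ l : Fin d, Real.sin (k l) ≠ 0 := by
  rw [ae_all_iff]
  intro l
  rw [ae_iff]
  simp only [not_not]
  have hc : ({t : ℝ | Real.sin t = 0}).Countable := by
    have : {t : ℝ | Real.sin t = 0} = Set.range (fun n : ℤ => (n : ℝ) * π) := by
      ext t; simp only [Set.mem_setOf_eq, Set.mem_range, Real.sin_eq_zero_iff]
    rw [this]; exact Set.countable_range _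
  have h0 : μI {t : ℝ | Real.sin t = 0} = 0 := by
    have hv : volume {t : ℝ | Real.sin t = 0} = 0 := hc.measure_zero volume
    exact le_antisymm ((Measure.restrict_apply_le _ _).trans hv.le) bot_le
  exact Measure.pi_eval_preimage_null (μ := fun _ : Fin d => μI) (i := l) h0

/-- `sin t ≠ 0 ⇒ |cos t| < 1`. [folklore] -/
theorem abs_cos_lt_one_of_sin_ne_zero {t : ℝ} (h : Real.sin t ≠ 0) : |Real.cos t| < 1 := by
  rw [← sq_lt_one_iff_abs_lt_one]
  have h1 := Real.sin_sq_add_cos_sq t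
  have hs : 0 < Real.sin t ^ 2 := lt_of_le_of_ne (sq_nonneg _) (Ne.symm (pow_ne_zero 2 h))
  linarith

/-- `|D̂_d(k)| < 1` as soon as every `|cos k_j| < 1` (`d ≥ 1`). [folklore] -/
theorem abs_Dhat_lt_one (hd : 1 ≤ d) {k : Fin d → ℝ} (h : ∀ j, |Real.cos (k j)| < 1) :
    |Dhat d k| < 1 := by
  have hd' : (0 : ℝ) < d := by exact_mod_cast hd
  rw [Dhat_def, abs_div, abs_of_pos hd', div_lt_one hd']
  calc |∑ j, Real.cos (k j)| ≤ ∑ j, |Real.cos (k j)| := abs_sum_le_sum_abs _ _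
    _ < ∑ _j : Fin d, (1 : ℝ) := sum_lt_sum_of_nonempty ⟨⟨0, hd⟩, mem_univ _⟩ fun j _ => h j
    _ = d := by simp

/-- `t ↦ (t^N + (-t)^N)/2` is convex on `ℝ` (it is `t^N` for even `N`, `0` for odd `N`).
[folklore] -/
theorem convexOn_evenPart_pow (N : ℕ) :
    ConvexOn ℝ Set.univ (fun t : ℝ => (t ^ N + (-t) ^ N) / 2) := by
  rcases Nat.even_or_odd N with hN | hN
  · have : (fun t : ℝ => (t ^ N + (-t) ^ N) / 2) = fun t => t ^ N := by
      funext t; rw [hN.neg_pow]; ring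
    rw [this]; exact hN.convexOn_pow
  · have : (fun t : ℝ => (t ^ N + (-t) ^ N) / 2) = fun _ => (0 : ℝ) := by
      funext t; rw [hN.neg_pow]; ring
    rw [this]; exact convexOn_const 0 convex_univ

/-- Finite Jensen with equal weights on `Fin (d+1)`. [folklore] -/
theorem _root_.ConvexOn.map_avg_le {g : ℝ → ℝ} (hg : ConvexOn ℝ Set.univ g)
    (s : Fin (d + 1) → ℝ) : g ((∑ i, s i) / (d + 1)) ≤ (∑ i, g (s i)) / (d + 1) := by
  have hw : (0 : ℝ) < (d : ℝ) + 1 := by positivity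
  have h1 : ∑ _i : Fin (d + 1), ((d : ℝ) + 1)⁻¹ = 1 := by
    rw [sum_const, card_univ, Fintype.card_fin, nsmul_eq_mul]; push_cast; field_simp
  have h := hg.map_sum_le (t := (univ : Finset (Fin (d + 1)))) (w := fun _ => ((d : ℝ) + 1)⁻¹)
    (p := s) (fun _ _ => by positivity) h1 (fun _ _ => Set.mem_univ _)
  have e1 : (∑ i, s i) / ((d : ℝ) + 1) = ∑ i, ((d : ℝ) + 1)⁻¹ • s i := by
    rw [sum_div]; exact sum_congr rfl fun i _ => by rw [smul_eq_mul, div_eq_inv_mul]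
  have e2 : (∑ i, g (s i)) / ((d : ℝ) + 1) = ∑ i, ((d : ℝ) + 1)⁻¹ • g (s i) := by
    rw [sum_div]; exact sum_congr rfl fun i _ => by rw [smul_eq_mul, div_eq_inv_mul]
  rw [e1, e2]; exact h

/-- The binomial series of the even part: for `|t| < 1`,
`ψ_{q+1,m}(t) = Σ_n C(n+q,q) (t^{n+m} + (-t)^{n+m})/2`. [folklore] -/
theorem hasSum_psi (q m : ℕ) {t : ℝ} (ht : |t| < 1) :
    HasSum (fun n : ℕ => (((n + q).choose q : ℕ) : ℝ) * ((t ^ (n + m) + (-t) ^ (n + m)) / 2))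
      (psi (q + 1) m t) := by
  have ht' : ‖t‖ < 1 := by rwa [Real.norm_eq_abs]
  have hnt' : ‖-t‖ < 1 := by rwa [norm_neg]
  have h1 := (hasSum_choose_mul_geometric_of_norm_lt_one q ht').mul_left (t ^ m)
  have h2 := (hasSum_choose_mul_geometric_of_norm_lt_one q hnt').mul_left ((-t) ^ m)
  have h := (h1.add h2).div_const 2
  have hf : (fun n : ℕ => (((n + q).choose q : ℕ) : ℝ) * ((t ^ (n + m) + (-t) ^ (n + m)) / 2)) =
      fun i : ℕ => (t ^ m * ((((i + q).choose q : ℕ) : ℝ) * t ^ i) +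
        (-t) ^ m * ((((i + q).choose q : ℕ) : ℝ) * (-t) ^ i)) / 2 := by
    funext n; ring
  have ha : psi (q + 1) m t =
      ((t ^ m * (1 / (1 - t) ^ (q + 1))) + (-t) ^ m * (1 / (1 - -t) ^ (q + 1))) / 2 := by
    simp only [psi, phi, one_div_pow]
  rw [hf, ha]; exact h

/-- **Jensen for `ψ`**: `ψ` of an average of numbers in `(-1,1)` is at most the average of `ψ`
(`ψ` is a nonnegative combination of even powers). [folklore] -/
theorem psi_avg_le (j m : ℕ) (s : Fin (d + 1) → ℝ) (hs : ∀ i, |s i| < 1) :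
    psi j m ((∑ i, s i) / (d + 1)) ≤ (∑ i, psi j m (s i)) / (d + 1) := by
  have havg : |(∑ i, s i) / (d + 1)| < 1 := by
    have hw : (0 : ℝ) < (d : ℝ) + 1 := by positivity
    rw [abs_div, abs_of_pos hw, div_lt_one hw]
    calc |∑ i, s i| ≤ ∑ i, |s i| := abs_sum_le_sum_abs _ _
      _ < ∑ _i : Fin (d + 1), (1 : ℝ) := sum_lt_sum_of_nonempty univ_nonempty fun i _ => hs i
      _ = (d : ℝ) + 1 := by simp
  cases j with
  | zero =>
    have hpsi : psi 0 m = fun t : ℝ => (t ^ m + (-t) ^ m) / 2 := by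
      funext t; simp [psi, phi]
    rw [hpsi]
    exact (convexOn_evenPart_pow m).map_avg_le s
  | succ q =>
    have hA := hasSum_psi q m havg
    have hB : HasSum (fun n : ℕ => (((n + q).choose q : ℕ) : ℝ) *
        ((∑ i, ((s i) ^ (n + m) + (-(s i)) ^ (n + m)) / 2) / (d + 1)))
        ((∑ i, psi (q + 1) m (s i)) / (d + 1)) := by
      have h := (hasSum_sum (s := (univ : Finset (Fin (d + 1))))
        (fun i _ => hasSum_psi q m (hs i))).div_const ((d : ℝ) + 1)
      have hf : (fun n : ℕ => (((n + q).choose q : ℕ) : ℝ) *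
          ((∑ i, ((s i) ^ (n + m) + (-(s i)) ^ (n + m)) / 2) / (d + 1))) =
          fun n : ℕ => (∑ i, (((n + q).choose q : ℕ) : ℝ) *
            (((s i) ^ (n + m) + (-(s i)) ^ (n + m)) / 2)) / ((d : ℝ) + 1) := by
        funext n; rw [mul_div_assoc', mul_sum]
      rw [hf]; exact h
    refine hasSum_le (fun n => ?_) hA hB
    exact mul_le_mul_of_nonneg_left ((convexOn_evenPart_pow (n + m)).map_avg_le s)
      (Nat.cast_nonneg _)

/-- `μI` has total mass `2π`. [folklore] -/
theorem μI_real_univ : μI.real Set.univ = 2 * π := by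
  have h := Slade2006Prop53.integral_one_μI
  rwa [integral_const, smul_eq_mul, mul_one] at h

/-- **Deleting one coordinate**: `∫_{[-π,π]^{d+1}} G(k^{(i)}) dk = 2π ∫_{[-π,π]^d} G(k') dk'`.
[folklore] -/
theorem integral_P_succ_comp_succAbove (d : ℕ) (i : Fin (d + 1)) (G : (Fin d → ℝ) → ℝ) :
    ∫ k, G (fun j => k (i.succAbove j)) ∂P (d + 1) = (2 * π) * ∫ k, G k ∂P d := by
  have hmp : MeasurePreserving (MeasurableEquiv.piFinSuccAbove (fun _ : Fin (d + 1) => ℝ) i)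
      (P (d + 1)) (μI.prod (P d)) :=
    measurePreserving_piFinSuccAbove (fun _ : Fin (d + 1) => μI) i
  have h := hmp.integral_comp' (g := fun z : ℝ × (Fin d → ℝ) => G z.2)
  have h2 : ∫ z : ℝ × (Fin d → ℝ), G z.2 ∂(μI.prod (P d)) = (2 * π) * ∫ k, G k ∂P d := by
    rw [integral_fun_snd, smul_eq_mul, μI_real_univ]
  rw [← h2, ← h]
  rfl

/-- Integrability transport for `k ↦ G(k^{(i)})`. [folklore] -/
theorem integrable_P_succ_comp_succAbove {d : ℕ} (i : Fin (d + 1)) {G : (Fin d → ℝ) → ℝ}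
    (hG : Integrable G (P d)) :
    Integrable (fun k : Fin (d + 1) → ℝ => G (fun j => k (i.succAbove j))) (P (d + 1)) := by
  have hmp : MeasurePreserving (MeasurableEquiv.piFinSuccAbove (fun _ : Fin (d + 1) => ℝ) i)
      (P (d + 1)) (μI.prod (P d)) :=
    measurePreserving_piFinSuccAbove (fun _ : Fin (d + 1) => μI) i
  have h2 : Integrable (fun z : ℝ × (Fin d → ℝ) => G z.2) (μI.prod (P d)) := by
    simpa only [one_mul] using (integrable_const (1 : ℝ)).mul_prod hG
  exact (hmp.integrable_comp_emb (MeasurableEquiv.measurableEmbedding _)).2 h2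

/-- The Jensen step at the level of integrals:
`∫_{[-π,π]^{d+1}} ψ(D̂_{d+1}) ≤ 2π ∫_{[-π,π]^d} ψ(D̂_d)` (`d ≥ 2j+1`). [folklore] -/
theorem integral_psi_succ_le {j : ℕ} (hd : 2 * j + 1 ≤ d) (m : ℕ) :
    ∫ k, psi j m (Dhat (d + 1) k) ∂P (d + 1) ≤ (2 * π) * ∫ k, psi j m (Dhat d k) ∂P d := by
  have hd1 : 2 * j + 1 ≤ d + 1 := by omega
  have hd0 : 1 ≤ d := by omega
  have hpt : ∀ᵐ k ∂P (d + 1), psi j m (Dhat (d + 1) k) ≤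
      (∑ i : Fin (d + 1), psi j m (Dhat d (fun l => k (i.succAbove l)))) / (d + 1) := by
    filter_upwards [ae_forall_sin_ne_zero (d + 1)] with k hk
    rw [Dhat_succ_eq_avg hd0 k]
    exact psi_avg_le j m _ fun i => abs_Dhat_lt_one hd0 fun l => abs_cos_lt_one_of_sin_ne_zero (hk _)
  have hint : ∀ i : Fin (d + 1), Integrable
      (fun k : Fin (d + 1) → ℝ => psi j m (Dhat d (fun l => k (i.succAbove l)))) (P (d + 1)) :=
    fun i => integrable_P_succ_comp_succAbove i (G := fun k' => psi j m (Dhat d k'))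
      (integrable_psi_Dhat hd m)
  calc ∫ k, psi j m (Dhat (d + 1) k) ∂P (d + 1)
      ≤ ∫ k, (∑ i : Fin (d + 1), psi j m (Dhat d (fun l => k (i.succAbove l)))) / (d + 1)
          ∂P (d + 1) :=
        integral_mono_ae (integrable_psi_Dhat hd1 m)
          ((integrable_finsetSum _ fun i _ => hint i).div_const _) hpt
    _ = (∑ i : Fin (d + 1), ∫ k, psi j m (Dhat d (fun l => k (i.succAbove l))) ∂P (d + 1)) /
          (d + 1) := by
        rw [integral_div, integral_finsetSum _ fun i _ => hint i]
    _ = (∑ _i : Fin (d + 1), (2 * π) * ∫ k, psi j m (Dhat d k) ∂P d) / (d + 1) := by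
        congr 1
        exact sum_congr rfl fun i _ =>
          integral_P_succ_comp_succAbove d i (fun k' => psi j m (Dhat d k'))
    _ = (2 * π) * ∫ k, psi j m (Dhat d k) ∂P d := by
        rw [sum_const, card_univ, Fintype.card_fin, nsmul_eq_mul]
        have hw : (d : ℝ) + 1 ≠ 0 := by positivity
        push_cast
        field_simp

end DimMono

open DimMono in
/-- **Monotonicity of the SRW integrals in the dimension.** For even `m` and `d ≥ 2j+1`,
`I^{(d+1)}_{j,m}(0) ≤ I^{(d)}_{j,m}(0)`; in particular (`j = 0`) the return probabilities
`p_m(0; d)` and (`m` even) `I_{j,m}(0;d) = K_{j,m}(0;d)` are non-increasing in `d`. This is the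
monotonicity in `d` invoked in [NoBLE17] §2.5 p. 1062 / §6 p. 1104 for the passage to all
`d ≥ 11` in [FvdH17] Thm 1.1, here PROVED for the SRW inputs by leave-one-out Jensen (`D̂_{d+1}` is the average of the `d+1` deleted
`D̂_d`'s and the even part of `t^m (1-t)^{-j}` is a nonnegative combination of even powers).
[cite: FitznerVanDerHofstad2016NoBLE, §2.5 p. 1062 and §6 p. 1104 (monotonicity in d, asserted)] -/
theorem srwI_zero_dim_succ_le {j m : ℕ} (hm : Even m) (hd : 2 * j + 1 ≤ d) :
    srwI (d + 1) j m 0 ≤ srwI d j m 0 := by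
  have hd1 : 2 * j + 1 ≤ d + 1 := by omega
  have _hm := hm
  rw [srwI_zero_eq_integral_phi, srwI_zero_eq_integral_phi, ← integral_psi_Dhat hd1,
    ← integral_psi_Dhat hd, pow_succ]
  calc (∫ k, psi j m (Dhat (d + 1) k) ∂P (d + 1)) / ((2 * π) ^ d * (2 * π))
      ≤ ((2 * π) * ∫ k, psi j m (Dhat d k) ∂P d) / ((2 * π) ^ d * (2 * π)) :=
        div_le_div_of_nonneg_right (integral_psi_succ_le hd m) (by positivity)
    _ = (∫ k, psi j m (Dhat d k) ∂P d) / (2 * π) ^ d := by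
        rw [mul_comm (2 * π) (∫ k, psi j m (Dhat d k) ∂P d),
          mul_div_mul_right _ _ (by positivity : (2 : ℝ) * π ≠ 0)]

/-- `I^{(d')}_{j,m}(0) ≤ I^{(d)}_{j,m}(0)` for `d ≤ d'`, `m` even, `d ≥ 2j+1`.
[cite: FitznerVanDerHofstad2016NoBLE, §2.5 p. 1062 and §6 p. 1104 (monotonicity in d, asserted)] -/
theorem srwI_zero_dim_anti {j m d d' : ℕ} (hm : Even m) (hd : 2 * j + 1 ≤ d) (hdd' : d ≤ d') :
    srwI d' j m 0 ≤ srwI d j m 0 := by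
  induction d', hdd' using Nat.le_induction with
  | base => exact le_rfl
  | succ d' hle ih => exact (srwI_zero_dim_succ_le hm (by omega)).trans ih

/-- The return probabilities are non-increasing in `d`: `p^{(d')}_m(0) ≤ p^{(d)}_m(0)`
(`m` even, `1 ≤ d ≤ d'`). [folklore] -/
theorem srwLaw_zero_dim_anti {m d d' : ℕ} (hm : Even m) (hd : 1 ≤ d) (hdd' : d ≤ d') :
    srwLaw d' m 0 ≤ srwLaw d m 0 := by
  have h := srwI_zero_dim_anti (j := 0) hm (by omega) hdd'
  rwa [srwI_zero_eq_srwLaw, srwI_zero_eq_srwLaw] at h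

/-! ### Part 3. The large-`d` enclosure -/

/-- **Large-`d` enclosure of the SRW inputs.** For `D₀ ≤ d`, `2(n+1)+1 ≤ D₀` and `l+R+1`
even, `|I^{(d)}_{n+1,l}(x) - Σ_{i ≤ R} C(i+n,n) p^{(d)}_{l+i}(x)| ≤
Σ_{t ≤ n} C(R+t,t) I^{(D₀)}_{n+1-t,l+R+1}(0)`: at every dimension `d ≥ D₀` each SRW input is
its explicit Taylor polynomial (walk counts, polynomial in `1/d`) up to a remainder that is
certified ONCE, at `d = D₀` (Taylor form + `|I_{n,2q}(x)| ≤ I_{n,2q}(0)` + monotonicity in `d`).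
[cite: FitznerVanDerHofstad2016NoBLE, (5.1) p. 1090 and §2.5 p. 1062] -/
theorem abs_srwI_sub_taylor_le {D₀ d n l R : ℕ} (hD : 2 * (n + 1) + 1 ≤ D₀) (hd : D₀ ≤ d)
    (he : Even (l + R + 1)) (x : Fin d → ℤ) :
    |srwI d (n + 1) l x - ∑ i ∈ range (R + 1), (((i + n).choose n : ℕ) : ℝ) * srwLaw d (l + i) x|
      ≤ ∑ t ∈ range (n + 1), (((R + t).choose t : ℕ) : ℝ) * srwI D₀ (n + 1 - t) (l + R + 1) 0 := by
  rw [srwI_taylor n l R (hD.trans hd) x, add_sub_cancel_left]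
  refine (abs_sum_le_sum_abs _ _).trans (sum_le_sum fun t ht => ?_)
  rw [mem_range] at ht
  rw [abs_mul, Nat.abs_cast]
  refine mul_le_mul_of_nonneg_left ?_ (Nat.cast_nonneg _)
  obtain ⟨q, hq⟩ := he
  have h1 : |srwI d (n + 1 - t) (l + R + 1) x| ≤ srwI d (n + 1 - t) (l + R + 1) 0 := by
    have h := abs_srwI_le_srwI_zero_of_even (d := d) (n := n + 1 - t) (by omega) q x
    rwa [show 2 * q = l + R + 1 by omega] at h
  exact h1.trans (srwI_zero_dim_anti ⟨q, hq⟩ (by omega) hd)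

/-- Convenience form of the enclosure with a common bound `B` on the anchor values
`I^{(D₀)}_{n+1-t,l+R+1}(0) ≤ B` (`t ≤ n`): the remainder is at most `C(R+n+1,n) · B`
(hockey stick `Σ_{t ≤ n} C(R+t,t) = C(R+n+1,n)`). [folklore] -/
theorem abs_srwI_sub_taylor_le_of_le {D₀ d n l R : ℕ} (hD : 2 * (n + 1) + 1 ≤ D₀) (hd : D₀ ≤ d)
    (he : Even (l + R + 1)) (x : Fin d → ℤ) {B : ℝ}
    (hB : ∀ t ∈ range (n + 1), srwI D₀ (n + 1 - t) (l + R + 1) 0 ≤ B) :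
    |srwI d (n + 1) l x - ∑ i ∈ range (R + 1), (((i + n).choose n : ℕ) : ℝ) * srwLaw d (l + i) x|
      ≤ (((R + n + 1).choose n : ℕ) : ℝ) * B := by
  refine (abs_srwI_sub_taylor_le hD hd he x).trans ?_
  calc ∑ t ∈ range (n + 1), (((R + t).choose t : ℕ) : ℝ) * srwI D₀ (n + 1 - t) (l + R + 1) 0
      ≤ ∑ t ∈ range (n + 1), (((R + t).choose t : ℕ) : ℝ) * B :=
        sum_le_sum fun t ht => mul_le_mul_of_nonneg_left (hB t ht) (Nat.cast_nonneg _)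
    _ = (((R + n + 1).choose n : ℕ) : ℝ) * B := by
        rw [← sum_mul, ← Nat.cast_sum]
        congr 2
        have h := Nat.sum_range_add_choose n R
        rw [Nat.choose_symm_of_eq_add (by ring : R + n + 1 = n + (R + 1)),
          show R + n + 1 = n + R + 1 by ring, ← h]
        exact sum_congr rfl fun t _ => by rw [Nat.choose_symm_of_eq_add (add_comm R t), add_comm R t]

/-- **One anchor table for every `l`.** In `abs_srwI_sub_taylor_le` the remainder is controlled by the
values `I^{(D₀)}_{j, l+R+1}(0)`; since `m ↦ I_{j,m}(0)` is non-increasing along EVEN `m`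
(`srwK_anti` + `srwK_zero_even`) and `t ↦ C(R+t,t)` is monotone in `R`, any fixed even level
`R₀ + 1 ≤ l + R + 1` with `R ≤ R₀` serves as a common anchor: with upper bounds `B j ≥ I^{(D₀)}_{j,R₀+1}(0)`
(`1 ≤ j ≤ n+1`), for every `d ≥ D₀`, every `x` and every `l`,
`|I^{(d)}_{n+1,l}(x) − Σ_{i≤R} C(i+n,n) p^{(d)}_{l+i}(x)| ≤ Σ_{t≤n} C(R₀+t,t) · B(n+1−t)`.
(Used with `D₀ = 50`, `R₀ = 99`, `R ∈ {98, 99}` according to the parity of `l`: one remainder table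
`ε_n` for all reads `I_{n,l}(x)`, LARGE-D.md §3.1/§6.) [folklore]
[cite: FitznerVanDerHofstad2021LTLA, §9 step (2) and Def. 9.1 (monotone-in-d SRW inputs, LA case)] -/
theorem abs_srwI_sub_taylor_le_anchor {D₀ d n l R R₀ : ℕ} (hD : 2 * (n + 1) + 1 ≤ D₀) (hd : D₀ ≤ d)
    (he : Even (l + R + 1)) (he₀ : Even (R₀ + 1)) (hR : R ≤ R₀) (hle : R₀ + 1 ≤ l + R + 1)
    (x : Fin d → ℤ) {B : ℕ → ℝ} (hB : ∀ j, 1 ≤ j → j ≤ n + 1 → srwI D₀ j (R₀ + 1) 0 ≤ B j) :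
    |srwI d (n + 1) l x - ∑ i ∈ range (R + 1), (((i + n).choose n : ℕ) : ℝ) * srwLaw d (l + i) x|
      ≤ ∑ t ∈ range (n + 1), (((R₀ + t).choose t : ℕ) : ℝ) * B (n + 1 - t) := by
  refine (abs_srwI_sub_taylor_le hD hd he x).trans (sum_le_sum fun t ht => ?_)
  have htn : t < n + 1 := mem_range.mp ht
  obtain ⟨a, ha⟩ := he
  obtain ⟨b, hb⟩ := he₀
  have ha' : l + R + 1 = 2 * a := by omega
  have hb' : R₀ + 1 = 2 * b := by omega
  have hj : 2 * (n + 1 - t) + 1 ≤ D₀ := by omega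
  -- the srwI factor: even-level monotonicity at x = 0, then the anchor bound
  have h1 : srwI D₀ (n + 1 - t) (l + R + 1) 0 ≤ srwI D₀ (n + 1 - t) (R₀ + 1) 0 := by
    rw [ha', hb', ← srwK_zero_even, ← srwK_zero_even]
    exact srwK_anti hj 0 (by omega)
  have h2 : srwI D₀ (n + 1 - t) (R₀ + 1) 0 ≤ B (n + 1 - t) := hB _ (by omega) (by omega)
  have h0 : 0 ≤ srwI D₀ (n + 1 - t) (l + R + 1) 0 := by rw [ha']; exact srwI_zero_even_nonneg _ _
  -- the binomial factor: `C(R+t,t) ≤ C(R₀+t,t)`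
  have hC : (((R + t).choose t : ℕ) : ℝ) ≤ (((R₀ + t).choose t : ℕ) : ℝ) :=
    Nat.cast_le.mpr (Nat.choose_le_choose t (by omega))
  calc (((R + t).choose t : ℕ) : ℝ) * srwI D₀ (n + 1 - t) (l + R + 1) 0
      ≤ (((R₀ + t).choose t : ℕ) : ℝ) * srwI D₀ (n + 1 - t) (l + R + 1) 0 :=
        mul_le_mul_of_nonneg_right hC h0
    _ ≤ (((R₀ + t).choose t : ℕ) : ℝ) * B (n + 1 - t) :=
        mul_le_mul_of_nonneg_left (h1.trans h2) (Nat.cast_nonneg _)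

end Literature.Probability.FitznerVanDerHofstad2017

end
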